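import Mathlib
import Summits.AnomalousDissipation.AnomalousDissipation.Theorems.MarginalStabilityChainStretchedVortexRowsStubRowVorticityConstructionToolsStream

/-!
# Stub `stub_rowVorticityConstruction` (crux stmt-AnomalousDissipation-3009) — tools VII:
# `∂_yΨ = (2π/L)U`, `∂ₓΨ = (2π/L)V` on the strip, and the cylinder Biot–Savart field is divergence free

Helper file (supports stmt-AnomalousDissipation-3009), continuation of tools VI (`…ToolsStream`): the interval
integration by parts in `q₁` (periodic boundary terms cancel), the two Fubini assemblies
`dY_rowStream : ∂_y ∫_{S_L} Φ_L ω(· − q) = (2π/L) ∫_{S_L} K₁ ω(· − q)`,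
`dX_rowStream : ∂ₓ ∫_{S_L} Φ_L ω(· − q) = (2π/L) ∫_{S_L} K₂ ω(· − q)` (a.e. `q₁ ≠ 0`, resp. a.e. `q₂ ≠ 0`), and
**`divFree_rowBS`**: for `ω ∈ C²`, `L`-periodic, with Gaussian bounds on `ω, Dω, D²ω`, the velocity
`u = −(2L)⁻¹∫ K₁ ω(· − q)`, `v = (2L)⁻¹ ∫ K₂ ω(· − q)` satisfies `∂ₓu + ∂_yv = 0` pointwise
(`u = −(4π)⁻¹∂_yΨ`, `v = (4π)⁻¹∂ₓΨ`, Schwarz). Registered sub-goal proved here: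
`stub_rowVorticityConstruction_biotSavartDivFree`. All `[folklore]`.
-/

set_option linter.dupNamespace false

noncomputable section

open Real Set Filter Topology MeasureTheory
open Literature.Analysis.FluidPDE Literature.Analysis.FluidPDE.StretchedLayer

namespace Summit.AnomalousDissipation.AnomalousDissipation.Theorems.MarginalStabilityChainStretchedVortexRows.RowBiotSavart

section Stream

variable {L : ℝ} {ω : ℝ → ℝ → ℝ} {C a C' a' : ℝ}

/-- Constants pass through `∂ₓ` of curried fields (no differentiability needed). [folklore] -/
theorem dX_const_mul (c : ℝ) (f : ℝ → ℝ → ℝ) (x y : ℝ) : dX (fun a b => c * f a b) x y = c * dX f x y := by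
  simp only [dX]; exact deriv_const_mul_field c

/-- Constants pass through `∂_y` of curried fields (no differentiability needed). [folklore] -/
theorem dY_const_mul (c : ℝ) (f : ℝ → ℝ → ℝ) (x y : ℝ) : dY (fun a b => c * f a b) x y = c * dY f x y := by
  simp only [dY]; exact deriv_const_mul_field c

/-- **IBP in `q₁` over the period**: for `q₂ ≠ 0`,
`∫_{(−L/2,L/2]} Φ_L(s, q₂) (∂ₓω)(x − s, y − q₂) ds = (2π/L) ∫_{(−L/2,L/2]} K₂(s, q₂) ω(x − s, y − q₂) ds`
(boundary terms cancel by `L`-periodicity of `Φ_L` and `ω`). [folklore] -/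
theorem integral_rowLogKer_mul_dX (hL : 0 < L) (hω : ContDiff ℝ 1 fun p : ℝ × ℝ => ω p.1 p.2)
    (hper : ∀ x y, ω (x + L) y = ω x y) {q₂ : ℝ} (hq₂ : q₂ ≠ 0) (x y : ℝ) :
    ∫ s in Ioc (-(L / 2)) (L / 2), Real.log (Real.cosh (2 * π * q₂ / L) - Real.cos (2 * π * s / L)) *
        dX ω (x - s) (y - q₂) =
      2 * π / L * ∫ s in Ioc (-(L / 2)) (L / 2),
        Real.sin (2 * π * s / L) / (Real.cosh (2 * π * q₂ / L) - Real.cos (2 * π * s / L)) * ω (x - s) (y - q₂) := by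
  have hle : -(L / 2) ≤ L / 2 := by linarith
  set U : ℝ → ℝ := fun s => Real.log (Real.cosh (2 * π * q₂ / L) - Real.cos (2 * π * s / L))
  set U' : ℝ → ℝ := fun s =>
    2 * π / L * (Real.sin (2 * π * s / L) / (Real.cosh (2 * π * q₂ / L) - Real.cos (2 * π * s / L)))
  set V : ℝ → ℝ := fun s => ω (x - s) (y - q₂)
  set V' : ℝ → ℝ := fun s => -dX ω (x - s) (y - q₂)
  have hD : ∀ s, 0 < Real.cosh (2 * π * q₂ / L) - Real.cos (2 * π * s / L) := rowDen_pos_of_snd hL hq₂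
  have hU : ∀ s, HasDerivAt U (U' s) s := fun s => hasDerivAt_rowLogKer_fst (hD s)
  have hV : ∀ s, HasDerivAt V (V' s) s := fun s =>
    HasDerivAt.comp_const_sub x s (hasDerivAt_slice_fst hω (x - s) (y - q₂))
  have cU' : Continuous U' := by
    refine continuous_const.mul (Continuous.div (by fun_prop) (by fun_prop) fun s => (hD s).ne')
  have cV' : Continuous V' :=
    ((continuous_dX hω).comp ((continuous_const.sub continuous_id).prodMk continuous_const)).neg
  have h := intervalIntegral.integral_mul_deriv_eq_deriv_mul (a := -(L / 2)) (b := L / 2)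
    (fun s _ => hU s) (fun s _ => hV s) (cU'.intervalIntegrable _ _) (cV'.intervalIntegrable _ _)
  -- the boundary terms cancel
  have hUb : U (-(L / 2)) = U (L / 2) := by
    simp only [U]
    rw [show 2 * π * -(L / 2) / L = -(2 * π * (L / 2) / L) by ring, Real.cos_neg]
  have hVb : V (-(L / 2)) = V (L / 2) := by
    simp only [V]
    rw [show x - -(L / 2) = x - L / 2 + L by ring, hper]
  rw [hUb, hVb, sub_self, zero_sub] at h
  rw [← intervalIntegral.integral_of_le hle, ← intervalIntegral.integral_of_le hle]
  have h2 : (∫ s in -(L / 2)..L / 2, U s * V' s) = -∫ s in -(L / 2)..L / 2, U s * dX ω (x - s) (y - q₂) := by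
    rw [← intervalIntegral.integral_neg]
    refine intervalIntegral.integral_congr fun s _ => ?_
    simp [V']
  rw [h2, neg_inj] at h
  rw [h, ← intervalIntegral.integral_const_mul]
  refine intervalIntegral.integral_congr fun s _ => ?_
  simp only [U', V]; ring

/-- `|ω| ≤ C e^{−ay²}` and `‖Dω‖ ≤ C' e^{−a'y²}` from Gaussian bounds on the iterated derivatives of orders
`0, 1`. [folklore] -/
theorem gaussBounds_of_iterated (hB : ∀ i ≤ 1, ∃ C a : ℝ, 0 < a ∧
      ∀ p, ‖iteratedFDeriv ℝ i (fun p : ℝ × ℝ => ω p.1 p.2) p‖ ≤ C * Real.exp (-a * p.2 ^ 2)) :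
    (∃ C a : ℝ, 0 < a ∧ ∀ x y, |ω x y| ≤ C * Real.exp (-a * y ^ 2)) ∧
      ∃ C' a' : ℝ, 0 < a' ∧ ∀ p, ‖fderiv ℝ (fun p : ℝ × ℝ => ω p.1 p.2) p‖ ≤ C' * Real.exp (-a' * p.2 ^ 2) := by
  obtain ⟨C, a, ha, h0⟩ := hB 0 zero_le_one
  obtain ⟨C', a', ha', h1⟩ := hB 1 le_rfl
  refine ⟨⟨C, a, ha, fun x y => ?_⟩, ⟨C', a', ha', fun p => ?_⟩⟩
  · have := h0 (x, y); rwa [norm_iteratedFDeriv_zero, Real.norm_eq_abs] at this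
  · have := h1 p; rwa [← norm_iteratedFDeriv_fderiv, norm_iteratedFDeriv_zero] at this

/-- **`∂_yΨ = (2π/L) U`**: for `ω ∈ C¹` with Gaussian bounds on `ω, Dω`,
`∂_y ∫_{S_L} Φ_L(q) ω(x − q₁, y − q₂) dq = (2π/L) ∫_{S_L} K₁(q) ω(x − q₁, y − q₂) dq`. [folklore] -/
theorem dY_rowStream (hL : 0 < L) (hω : ContDiff ℝ 1 fun p : ℝ × ℝ => ω p.1 p.2) (ha : 0 < a)
    (hb : ∀ x y, |ω x y| ≤ C * Real.exp (-a * y ^ 2)) (ha' : 0 < a')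
    (hb' : ∀ p, ‖fderiv ℝ (fun p : ℝ × ℝ => ω p.1 p.2) p‖ ≤ C' * Real.exp (-a' * p.2 ^ 2)) (x y : ℝ) :
    dY (fun x y => ∫ q in Ioc (-(L / 2)) (L / 2) ×ˢ (univ : Set ℝ),
        Real.log (Real.cosh (2 * π * q.2 / L) - Real.cos (2 * π * q.1 / L)) * ω (x - q.1) (y - q.2)) x y =
      2 * π / L * ∫ q in Ioc (-(L / 2)) (L / 2) ×ˢ (univ : Set ℝ),
        Real.sinh (2 * π * q.2 / L) / (Real.cosh (2 * π * q.2 / L) - Real.cos (2 * π * q.1 / L)) *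
          ω (x - q.1) (y - q.2) := by
  have hkΦ := (measurable_rowLogKer L).aestronglyMeasurable
    (μ := (volume : Measure (ℝ × ℝ)).restrict (Ioc (-(L / 2)) (L / 2) ×ˢ (univ : Set ℝ)))
  have hkU := (measurable_rowKerU L).aestronglyMeasurable
    (μ := (volume : Measure (ℝ × ℝ)).restrict (Ioc (-(L / 2)) (L / 2) ×ˢ (univ : Set ℝ)))
  rw [dY_rowConv hkΦ (gaussTestable_rowLogKer hL) hω ha hb ha' hb' x y]
  -- both sides as iterated integrals
  have hbY : ∀ p : ℝ × ℝ, ‖(fun p : ℝ × ℝ => dY ω p.1 p.2) p‖ ≤ C' * Real.exp (-a' * p.2 ^ 2) := fun p => by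
    rw [Real.norm_eq_abs]; exact abs_dY_le hω hb' p.1 p.2
  have hbF : ∀ p : ℝ × ℝ, ‖(fun p : ℝ × ℝ => ω p.1 p.2) p‖ ≤ C * Real.exp (-a * p.2 ^ 2) := fun p => by
    rw [Real.norm_eq_abs]; exact hb p.1 p.2
  have iL : Integrable (fun q : ℝ × ℝ => Real.log (Real.cosh (2 * π * q.2 / L) - Real.cos (2 * π * q.1 / L)) *
      dY ω (x - q.1) (y - q.2)) ((volume : Measure (ℝ × ℝ)).restrict (Ioc (-(L / 2)) (L / 2) ×ˢ (univ : Set ℝ))) := by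
    have := integrable_ker_smul hkΦ (gaussTestable_rowLogKer hL) (continuous_dY hω) ha' hbY (x, y)
    simpa only [smul_eq_mul, Prod.fst_sub, Prod.snd_sub] using this
  have iR : Integrable (fun q : ℝ × ℝ =>
      Real.sinh (2 * π * q.2 / L) / (Real.cosh (2 * π * q.2 / L) - Real.cos (2 * π * q.1 / L)) *
        ω (x - q.1) (y - q.2)) ((volume : Measure (ℝ × ℝ)).restrict (Ioc (-(L / 2)) (L / 2) ×ˢ (univ : Set ℝ))) := by
    have := integrable_ker_smul hkU (gaussTestable_rowKerU hL) hω.continuous ha hbF (x, y)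
    simpa only [smul_eq_mul, Prod.fst_sub, Prod.snd_sub] using this
  rw [volume_restrict_strip] at iL iR ⊢
  rw [integral_prod _ iL, integral_prod _ iR, ← integral_const_mul]
  refine integral_congr_ae ?_
  have hae : ∀ᵐ q₁ ∂(volume : Measure ℝ), q₁ ≠ 0 := by simp [ae_iff]
  filter_upwards [ae_restrict_mem measurableSet_Ioc, ae_restrict_of_ae hae] with q₁ hq₁ h0
  exact integral_rowLogKer_mul_dY hL hω ha hb ha' hb' hq₁ h0 x y

/-- **`∂ₓΨ = (2π/L) V`**: for `ω ∈ C¹`, `L`-periodic, with Gaussian bounds on `ω, Dω`,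
`∂ₓ ∫_{S_L} Φ_L(q) ω(x − q₁, y − q₂) dq = (2π/L) ∫_{S_L} K₂(q) ω(x − q₁, y − q₂) dq`. [folklore] -/
theorem dX_rowStream (hL : 0 < L) (hω : ContDiff ℝ 1 fun p : ℝ × ℝ => ω p.1 p.2) (ha : 0 < a)
    (hb : ∀ x y, |ω x y| ≤ C * Real.exp (-a * y ^ 2)) (ha' : 0 < a')
    (hb' : ∀ p, ‖fderiv ℝ (fun p : ℝ × ℝ => ω p.1 p.2) p‖ ≤ C' * Real.exp (-a' * p.2 ^ 2))
    (hper : ∀ x y, ω (x + L) y = ω x y) (x y : ℝ) :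
    dX (fun x y => ∫ q in Ioc (-(L / 2)) (L / 2) ×ˢ (univ : Set ℝ),
        Real.log (Real.cosh (2 * π * q.2 / L) - Real.cos (2 * π * q.1 / L)) * ω (x - q.1) (y - q.2)) x y =
      2 * π / L * ∫ q in Ioc (-(L / 2)) (L / 2) ×ˢ (univ : Set ℝ),
        Real.sin (2 * π * q.1 / L) / (Real.cosh (2 * π * q.2 / L) - Real.cos (2 * π * q.1 / L)) *
          ω (x - q.1) (y - q.2) := by
  have hkΦ := (measurable_rowLogKer L).aestronglyMeasurable
    (μ := (volume : Measure (ℝ × ℝ)).restrict (Ioc (-(L / 2)) (L / 2) ×ˢ (univ : Set ℝ)))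
  have hkV := (measurable_rowKerV L).aestronglyMeasurable
    (μ := (volume : Measure (ℝ × ℝ)).restrict (Ioc (-(L / 2)) (L / 2) ×ˢ (univ : Set ℝ)))
  rw [dX_rowConv hkΦ (gaussTestable_rowLogKer hL) hω ha hb ha' hb' x y]
  have hbX : ∀ p : ℝ × ℝ, ‖(fun p : ℝ × ℝ => dX ω p.1 p.2) p‖ ≤ C' * Real.exp (-a' * p.2 ^ 2) := fun p => by
    rw [Real.norm_eq_abs]; exact abs_dX_le hω hb' p.1 p.2
  have hbF : ∀ p : ℝ × ℝ, ‖(fun p : ℝ × ℝ => ω p.1 p.2) p‖ ≤ C * Real.exp (-a * p.2 ^ 2) := fun p => by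
    rw [Real.norm_eq_abs]; exact hb p.1 p.2
  have iL : Integrable (fun q : ℝ × ℝ => Real.log (Real.cosh (2 * π * q.2 / L) - Real.cos (2 * π * q.1 / L)) *
      dX ω (x - q.1) (y - q.2)) ((volume : Measure (ℝ × ℝ)).restrict (Ioc (-(L / 2)) (L / 2) ×ˢ (univ : Set ℝ))) := by
    have := integrable_ker_smul hkΦ (gaussTestable_rowLogKer hL) (continuous_dX hω) ha' hbX (x, y)
    simpa only [smul_eq_mul, Prod.fst_sub, Prod.snd_sub] using this
  have iR : Integrable (fun q : ℝ × ℝ =>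
      Real.sin (2 * π * q.1 / L) / (Real.cosh (2 * π * q.2 / L) - Real.cos (2 * π * q.1 / L)) *
        ω (x - q.1) (y - q.2)) ((volume : Measure (ℝ × ℝ)).restrict (Ioc (-(L / 2)) (L / 2) ×ˢ (univ : Set ℝ))) := by
    have := integrable_ker_smul hkV (gaussTestable_rowKerV hL) hω.continuous ha hbF (x, y)
    simpa only [smul_eq_mul, Prod.fst_sub, Prod.snd_sub] using this
  rw [volume_restrict_strip] at iL iR ⊢
  rw [integral_prod_symm _ iL, integral_prod_symm _ iR, ← integral_const_mul]
  refine integral_congr_ae ?_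
  have hae : ∀ᵐ q₂ ∂(volume : Measure ℝ), q₂ ≠ 0 := by simp [ae_iff]
  filter_upwards [hae] with q₂ h0
  exact integral_rowLogKer_mul_dX hL hω hper h0 x y

/-- **The cylinder Biot–Savart field is divergence free.** For `ω ∈ C²`, `L`-periodic in `x`, with Gaussian
bounds on `ω, Dω, D²ω`: `∂ₓu + ∂_yv = 0` for `u = −(2L)⁻¹ ∫_{S_L} K₁ ω(· − q)`, `v = (2L)⁻¹ ∫_{S_L} K₂ ω(· − q)`.
[folklore] -/
theorem divFree_rowBS (hL : 0 < L) (hω : ContDiff ℝ 2 fun p : ℝ × ℝ => ω p.1 p.2)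
    (hB : ∀ i ≤ 2, ∃ C a : ℝ, 0 < a ∧
      ∀ p, ‖iteratedFDeriv ℝ i (fun p : ℝ × ℝ => ω p.1 p.2) p‖ ≤ C * Real.exp (-a * p.2 ^ 2))
    (hper : ∀ x y, ω (x + L) y = ω x y) (x y : ℝ) :
    dX (fun a b => -(1 / (2 * L)) * ∫ q in Ioc (-(L / 2)) (L / 2) ×ˢ (univ : Set ℝ),
        Real.sinh (2 * π * q.2 / L) / (Real.cosh (2 * π * q.2 / L) - Real.cos (2 * π * q.1 / L)) *
          ω (a - q.1) (b - q.2)) x y +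
      dY (fun a b => 1 / (2 * L) * ∫ q in Ioc (-(L / 2)) (L / 2) ×ˢ (univ : Set ℝ),
        Real.sin (2 * π * q.1 / L) / (Real.cosh (2 * π * q.2 / L) - Real.cos (2 * π * q.1 / L)) *
          ω (a - q.1) (b - q.2)) x y = 0 := by
  have hω1 : ContDiff ℝ 1 fun p : ℝ × ℝ => ω p.1 p.2 := hω.of_le one_le_two
  obtain ⟨⟨C, a, ha, hb⟩, ⟨C', a', ha', hb'⟩⟩ := gaussBounds_of_iterated (ω := ω) fun i hi => hB i (hi.trans one_le_two)
  -- the stream integral `Ψ` (without the factor `(4π)⁻¹`) is `C²`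
  set Ψ : ℝ → ℝ → ℝ := fun a b => ∫ q in Ioc (-(L / 2)) (L / 2) ×ˢ (univ : Set ℝ),
    Real.log (Real.cosh (2 * π * q.2 / L) - Real.cos (2 * π * q.1 / L)) * ω (a - q.1) (b - q.2) with hΨ
  have hΨ2 : ContDiff ℝ 2 fun p : ℝ × ℝ => Ψ p.1 p.2 :=
    contDiff_rowConv ((measurable_rowLogKer L).aestronglyMeasurable) (gaussTestable_rowLogKer hL) 2 hω hB
  -- `u = −(4π)⁻¹ ∂_yΨ`, `v = (4π)⁻¹ ∂ₓΨ` as functions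
  have hπ : (π : ℝ) ≠ 0 := Real.pi_pos.ne'
  have hu : (fun a b => -(1 / (2 * L)) * ∫ q in Ioc (-(L / 2)) (L / 2) ×ˢ (univ : Set ℝ),
      Real.sinh (2 * π * q.2 / L) / (Real.cosh (2 * π * q.2 / L) - Real.cos (2 * π * q.1 / L)) *
        ω (a - q.1) (b - q.2)) = fun a b => -(1 / (4 * π)) * dY Ψ a b := by
    funext a b
    rw [hΨ, dY_rowStream hL hω1 ha hb ha' hb' a b]
    field_simp
    ring
  have hv : (fun a b => 1 / (2 * L) * ∫ q in Ioc (-(L / 2)) (L / 2) ×ˢ (univ : Set ℝ),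
      Real.sin (2 * π * q.1 / L) / (Real.cosh (2 * π * q.2 / L) - Real.cos (2 * π * q.1 / L)) *
        ω (a - q.1) (b - q.2)) = fun a b => 1 / (4 * π) * dX Ψ a b := by
    funext a b
    rw [hΨ, dX_rowStream hL hω1 ha hb ha' hb' hper a b]
    field_simp
    ring
  rw [hu, hv, dX_const_mul, dY_const_mul, dX_dY_comm hΨ2 x y]
  ring

end Stream

end RowBiotSavart

open RowBiotSavart in
/-- **The cylinder Biot–Savart velocity of an `L`-periodic Gaussian-tailed `C²` vorticity is divergence free**
(registered on stmt-AnomalousDissipation-3009 as the helper stub `stub_rowVorticityConstruction_biotSavartDivFree`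
of `stub_rowVorticityConstruction`): `∂ₓu + ∂_yv = 0` for `u = −(2L)⁻¹ ∫_{S_L} K₁(q) ω(x − q₁, y − q₂) dq`,
`v = (2L)⁻¹ ∫_{S_L} K₂(q) ω(x − q₁, y − q₂) dq` — the incompressibility clause of the stub's conclusion for the
reconstructed velocity (`RowBiotSavart.divFree_rowBS`). [folklore] -/
theorem stub_rowVorticityConstruction_biotSavartDivFree :
    ∀ (L : ℝ) (ω : ℝ → ℝ → ℝ), 0 < L → ContDiff ℝ 2 (fun p : ℝ × ℝ => ω p.1 p.2) →
      (∀ i ≤ 2, ∃ C a : ℝ, 0 < a ∧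
        ∀ p : ℝ × ℝ, ‖iteratedFDeriv ℝ i (fun p : ℝ × ℝ => ω p.1 p.2) p‖ ≤ C * Real.exp (-a * p.2 ^ 2)) →
      (∀ x y, ω (x + L) y = ω x y) →
      ∀ x y : ℝ,
        dX (fun a b => -(1 / (2 * L)) * ∫ q in Set.Ioc (-(L / 2)) (L / 2) ×ˢ (Set.univ : Set ℝ),
            Real.sinh (2 * Real.pi * q.2 / L) / (Real.cosh (2 * Real.pi * q.2 / L) - Real.cos (2 * Real.pi * q.1 / L)) *
              ω (a - q.1) (b - q.2)) x y +
          dY (fun a b => 1 / (2 * L) * ∫ q in Set.Ioc (-(L / 2)) (L / 2) ×ˢ (Set.univ : Set ℝ),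
            Real.sin (2 * Real.pi * q.1 / L) / (Real.cosh (2 * Real.pi * q.2 / L) - Real.cos (2 * Real.pi * q.1 / L)) *
              ω (a - q.1) (b - q.2)) x y = 0 :=
  fun _ _ hL hω hB hper x y => divFree_rowBS hL hω hB hper x y

end Summit.AnomalousDissipation.AnomalousDissipation.Theorems.MarginalStabilityChainStretchedVortexRows

end
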